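import Mathlib
import Summits.NavierStokesRegularity.NavierStokesRegularity.Theorems.FilamentSkeletonRssAreaLawSlavingHoloTrace

/-!
# Area-law slaving, complex part 5 — ZERO-FREENESS of the continued slip off its real zero
# (`FilamentSkeletonRss`, child crux `TangentSkeletonNearStraight`, stmt-NavierStokesRegularity-28295, line
# `child_tangent_analytic_strip`, ∃-side of the registered stub `stub_analyticClosing`: the `StadiumAnalyticArea` conjunct)

`Theorems.AreaLawSlavingHolo.areaLaw_holo` (part 4) continues the core area analytically along a slip `w` that is holomorphic on a
convex domain and ZERO-FREE off its real zero `c`.  On the real trace this is the crux's unique-zero clause; off the trace it must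
be proved.  This file gives the two mechanisms that cover a thin stadium:

* `sub_eq_mul_integral_deriv` — Hadamard along a segment of a convex open set: `w z₁ − w z₂ = (z₁ − z₂)·∫₀¹ w′(z₂ + t(z₁ − z₂)) dt`;
* `norm_sub_le_of_deriv_le` — hence `‖w z₁ − w z₂‖ ≤ M‖z₁ − z₂‖` when `‖w′‖ ≤ M` on the set;
* `injOn_of_deriv_sub_le` — NEAR THE ZERO: if `‖w′(z) − d‖ ≤ q < ‖d‖` on a convex open `K` then `w` is injective on `K`
  (so `c` is its only zero there; `ne_zero_of_deriv_sub_le`).  In the crux `d = w′(c) = O(1)` and `w″ = O(Γ^{-1/2})`, so `K` may be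
  taken a disc of radius `∼ √Γ ≫ cs√Γ` around `c`;
* `ne_zero_of_real_floor` — AWAY FROM THE ZERO: if `‖w′‖ ≤ M` on the convex open `U ∋ z, ↑(Re z)`, and the real slip floor
  `μ ≤ ‖w(Re z)‖` holds with `M·|Im z| < μ`, then `w z ≠ 0` (in the crux `μ = m|Re z − c|`, `|Im z| < cs√Γ`).

HONEST FRAMING: classical complex analysis serving a HYPOTHETICAL filament skeleton on the NEGATIVE side of a MODEL route; no
registered stub is closed by this file and nothing here bears on Navier–Stokes regularity or blow-up.
`--supports stmt-NavierStokesRegularity-28295`.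
-/

set_option linter.dupNamespace false

noncomputable section

namespace Summit.NavierStokesRegularity.NavierStokesRegularity.Theorems.AreaLawSlavingHolo

open Set MeasureTheory Metric Filter
open scoped Topology

/-- **Hadamard along a segment.**  `U` open convex, `w` holomorphic on `U`, `z₁, z₂ ∈ U`:
`w z₁ − w z₂ = (z₁ − z₂) · ∫₀¹ w′(z₂ + t·(z₁ − z₂)) dt`. [folklore] -/
theorem sub_eq_mul_integral_deriv {U : Set ℂ} (hUo : IsOpen U) (hUc : Convex ℝ U) {w : ℂ → ℂ}
    (hw : DifferentiableOn ℂ w U) {z₁ z₂ : ℂ} (hz₁ : z₁ ∈ U) (hz₂ : z₂ ∈ U) :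
    w z₁ - w z₂ = (z₁ - z₂) * ∫ t in (0:ℝ)..1, deriv w (z₂ + (t : ℂ) * (z₁ - z₂)) := by
  set V : Set ℂ := (fun z => z - z₂) '' U with hV
  have hVo : IsOpen V := isOpen_image_sub hUo z₂
  have hstar := star_of_convex hUc hz₂
  set wt : ℂ → ℂ := fun u => w (u + z₂) with hwt
  have hwtD : DifferentiableOn ℂ wt V := by
    refine (hw.comp ((differentiable_id.add_const z₂).differentiableOn) ?_)
    rintro _ ⟨u, hu, rfl⟩; simpa using hu
  have hmem : z₁ - z₂ ∈ V := ⟨z₁, hz₁, rfl⟩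
  have h := mul_integral_deriv_comp_mul hVo hstar hwtD hmem
  simp only [hwt, sub_add_cancel, zero_add] at h
  rw [← h]
  congr 1
  refine intervalIntegral.integral_congr fun t _ => ?_
  -- `deriv wt u = deriv w (u + z₂)`
  have hu : (t : ℂ) * (z₁ - z₂) + z₂ = z₂ + (t : ℂ) * (z₁ - z₂) := by ring
  show deriv (fun u => w (u + z₂)) ((t : ℂ) * (z₁ - z₂)) = deriv w (z₂ + (t : ℂ) * (z₁ - z₂))
  rw [← hu, deriv_comp_add_const]

/-- **Lipschitz bound from a derivative bound on a convex open set.** [folklore] -/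
theorem norm_sub_le_of_deriv_le {U : Set ℂ} (hUo : IsOpen U) (hUc : Convex ℝ U) {w : ℂ → ℂ}
    (hw : DifferentiableOn ℂ w U) {M : ℝ} (hM : ∀ z ∈ U, ‖deriv w z‖ ≤ M) {z₁ z₂ : ℂ} (hz₁ : z₁ ∈ U) (hz₂ : z₂ ∈ U) :
    ‖w z₁ - w z₂‖ ≤ M * ‖z₁ - z₂‖ := by
  rw [sub_eq_mul_integral_deriv hUo hUc hw hz₁ hz₂, norm_mul]
  have hseg : ∀ t : ℝ, t ∈ Icc (0:ℝ) 1 → z₂ + (t : ℂ) * (z₁ - z₂) ∈ U := by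
    intro t ht
    have h := hUc.add_smul_sub_mem hz₂ hz₁ ht
    simpa [Complex.real_smul] using h
  have hI : ‖∫ t in (0:ℝ)..1, deriv w (z₂ + (t : ℂ) * (z₁ - z₂))‖ ≤ M * |1 - 0| := by
    refine intervalIntegral.norm_integral_le_of_norm_le_const fun t ht => ?_
    rw [uIoc_of_le zero_le_one] at ht
    exact hM _ (hseg t ⟨ht.1.le, ht.2⟩)
  rw [sub_zero, abs_one, mul_one] at hI
  calc ‖z₁ - z₂‖ * ‖∫ t in (0:ℝ)..1, deriv w (z₂ + (t : ℂ) * (z₁ - z₂))‖ ≤ ‖z₁ - z₂‖ * M :=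
        mul_le_mul_of_nonneg_left hI (norm_nonneg _)
    _ = M * ‖z₁ - z₂‖ := mul_comm _ _

/-- **Injectivity near a non-degenerate point.**  `K` open convex, `w` holomorphic on `K` with `‖w′(z) − d‖ ≤ q` on `K` for a
constant `d` with `q < ‖d‖`.  Then `w` is injective on `K`. [folklore] -/
theorem injOn_of_deriv_sub_le {K : Set ℂ} (hKo : IsOpen K) (hKc : Convex ℝ K) {w : ℂ → ℂ} (hw : DifferentiableOn ℂ w K)
    {d : ℂ} {q : ℝ} (hq : ∀ z ∈ K, ‖deriv w z - d‖ ≤ q) (hqd : q < ‖d‖) : InjOn w K := by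
  intro z₁ hz₁ z₂ hz₂ heq
  by_contra hne
  have hsub : z₁ - z₂ ≠ 0 := sub_ne_zero.2 hne
  have h := sub_eq_mul_integral_deriv hKo hKc hw hz₁ hz₂
  rw [heq, sub_self] at h
  have hI0 : ∫ t in (0:ℝ)..1, deriv w (z₂ + (t : ℂ) * (z₁ - z₂)) = 0 := by
    rcases mul_eq_zero.1 h.symm with h1 | h1
    · exact absurd h1 hsub
    · exact h1
  -- but the integral is within `q` of `d ≠ 0`
  have hseg : ∀ t : ℝ, t ∈ Icc (0:ℝ) 1 → z₂ + (t : ℂ) * (z₁ - z₂) ∈ K := by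
    intro t ht
    have h := hKc.add_smul_sub_mem hz₂ hz₁ ht
    simpa [Complex.real_smul] using h
  have hcont : ContinuousOn (fun t : ℝ => deriv w (z₂ + (t : ℂ) * (z₁ - z₂))) (Icc (0:ℝ) 1) := by
    have hc : ContinuousOn (deriv w) K := (hw.analyticOnNhd hKo).deriv.continuousOn
    refine hc.comp (by fun_prop) fun t ht => hseg t ht
  have hint : IntervalIntegrable (fun t : ℝ => deriv w (z₂ + (t : ℂ) * (z₁ - z₂))) volume 0 1 := by
    refine ContinuousOn.intervalIntegrable ?_
    rw [uIcc_of_le zero_le_one]; exact hcont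
  have hdiff : ‖(∫ t in (0:ℝ)..1, deriv w (z₂ + (t : ℂ) * (z₁ - z₂))) - d‖ ≤ q := by
    have e : (∫ t in (0:ℝ)..1, deriv w (z₂ + (t : ℂ) * (z₁ - z₂))) - d =
        ∫ t in (0:ℝ)..1, (deriv w (z₂ + (t : ℂ) * (z₁ - z₂)) - d) := by
      rw [intervalIntegral.integral_sub hint intervalIntegrable_const, intervalIntegral.integral_const, sub_zero,
        one_smul]
    rw [e]
    have hI := intervalIntegral.norm_integral_le_of_norm_le_const (a := (0:ℝ)) (b := 1) (C := q)
      (f := fun t : ℝ => deriv w (z₂ + (t : ℂ) * (z₁ - z₂)) - d) (fun t ht => by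
        rw [uIoc_of_le zero_le_one] at ht
        exact hq _ (hseg t ⟨ht.1.le, ht.2⟩))
    simpa using hI
  rw [hI0, zero_sub, norm_neg] at hdiff
  linarith

/-- **Unique zero near a non-degenerate zero.**  Under the hypotheses of `injOn_of_deriv_sub_le`, if `w c = 0` for some `c ∈ K`,
then `w z ≠ 0` for every other `z ∈ K`. [folklore] -/
theorem ne_zero_of_deriv_sub_le {K : Set ℂ} (hKo : IsOpen K) (hKc : Convex ℝ K) {w : ℂ → ℂ} (hw : DifferentiableOn ℂ w K)
    {d : ℂ} {q : ℝ} (hq : ∀ z ∈ K, ‖deriv w z - d‖ ≤ q) (hqd : q < ‖d‖) {c : ℂ} (hc : c ∈ K) (hwc : w c = 0)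
    {z : ℂ} (hz : z ∈ K) (hzc : z ≠ c) : w z ≠ 0 := by
  intro h0
  exact hzc (injOn_of_deriv_sub_le hKo hKc hw hq hqd hz hc (by rw [h0, hwc]))

/-- **No zeros above a real slip floor.**  `U` open convex, `w` holomorphic on `U` with `‖w′‖ ≤ M` there; if `z ∈ U` and its real
foot `↑(Re z) ∈ U` carry the floor `μ ≤ ‖w(Re z)‖` with `M·|Im z| < μ`, then `w z ≠ 0`. [folklore] -/
theorem ne_zero_of_real_floor {U : Set ℂ} (hUo : IsOpen U) (hUc : Convex ℝ U) {w : ℂ → ℂ} (hw : DifferentiableOn ℂ w U)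
    {M : ℝ} (hM : ∀ z ∈ U, ‖deriv w z‖ ≤ M) {z : ℂ} (hz : z ∈ U) (hfoot : ((z.re : ℝ) : ℂ) ∈ U) {μ : ℝ}
    (hfloor : μ ≤ ‖w (z.re : ℂ)‖) (hthin : M * |z.im| < μ) : w z ≠ 0 := by
  intro h0
  have h := norm_sub_le_of_deriv_le hUo hUc hw hM hz hfoot
  rw [h0, zero_sub, norm_neg] at h
  have him : ‖z - (z.re : ℂ)‖ = |z.im| := by
    have : z - (z.re : ℂ) = (z.im : ℂ) * Complex.I := by
      apply Complex.ext <;> simp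
    rw [this, norm_mul, Complex.norm_I, mul_one, Complex.norm_real, Real.norm_eq_abs]
  rw [him] at h
  linarith

end Summit.NavierStokesRegularity.NavierStokesRegularity.Theorems.AreaLawSlavingHolo
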